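import Summits.Parity.BatemanHorn.Theorems.RoughParitySectorsRoughParityBalanceSignedSieveOut
import Summits.Parity.BatemanHorn.Theorems.RoughParitySectorsRoughParityBalanceLinearClassSums
import Summits.Parity.BatemanHorn.Theorems.RoughParitySectorsRoughParityBalanceRoughCardLower
import HarnessLib

/-!
# Route `RoughParitySectors`, crux `RoughParityBalance` (stmt-Parity-15627), line `registered` (birth):
# the reduction of the crux to its two open parity atoms

`--supports` file of the checked skeleton `Summits/Parity/BatemanHorn/Cruxes/RoughParityBalance/Lines/birth.lean`
(crux `Summit.Parity.BatemanHorn.Theses.RoughParitySectors.RoughParityBalance`).  Everything here is PROVED from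
the landed engine stubs `stub_signedSieveOut` (E2, signed sieve-out along a Bateman–Horn system),
`stub_linearClassSums` (E3, Bombieri–Vinogradov for `λ` along a linear member with root-count weights) and
`stub_roughCardLower` (E4, `#R_f(x,U) ≥ x/(log x)^A`), (the Walsh identity and the composition `roughParityBalance_of_parts` stay in the skeleton):

* `signSum_le_of_classSums` — a weight `|τ| ≤ 1` whose class sums
  `Σ_{d ≤ x^θ sqfree} Σ_{c : d ∣ ∏fᵢ(c)} |Σ_{n ≤ x, n ≡ c (d)} τ(n)|` are `≪_A x/(log x)^A` (every `A`, some `θ(A) > 0`)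
  has mean `o(#R_f(x,U))` over the jointly rough set as `U → ∞` (E2 + E4);
* `stub_linearMemberSign` — the registered stub: the first-order Walsh coefficient of a LINEAR member is `o(#R)`
  (E3 feeds `signSum_le_of_classSums`);
* `nonlinearMemberSign_of_classSums`, `jointSignIndependence_of_classSums` — the two OPEN atoms follow from the
  corresponding UNSIFTED level-`x^θ` class-sum bounds (one-point Chowla along a non-linear member in progressions
  on average; tuple Chowla in progressions on average), the exact typed inputs they reduce to;
* the crux BY NAME from the two atoms is then the one-line `RoughParityBalance_of` of the skeleton `Lines/birth.lean`
  (`roughParityBalance_of_parts stub_linearMemberSign stub_nonlinearMemberSign stub_jointSignIndependence`).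

So the crux is closed modulo exactly: one-point Liouville equidistribution along each member of degree ≥ 2 on the
jointly rough set, and joint sign independence of ≥ 2 members on the jointly rough set — the parity content of
Bateman–Horn (Selberg's barrier in its weakest, sifted, constant-free form; both open: Teräväinen 2024 §3.4 for
`λ(n²+1)`, Tao 2016 / Helfgott–Radziwiłł 2021 for log-averaged two-point Chowla only).
-/

namespace Summit.Parity.BatemanHorn.Cruxes.RoughParityBalance.Birth

open scoped BigOperators Topology Classical
open Filter Finset
open Literature.NumberTheory.Sieve

/-! ### Generic composition: a weight with small class sums has small mean on the rough set (E2 + E4) -/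

/-- Monotonicity of the stub remainder in the level: for `θ' ≤ θ` and `x ≥ 1` the double sum over squarefree
`d ≤ ⌊x^{θ'}⌋₊` is at most the one over `d ≤ ⌊x^θ⌋₊` (non-negative terms). [folklore] -/
theorem classSums_mono {k : ℕ} (f : Fin k → Polynomial ℤ) (τ : ℕ → ℝ) {x : ℕ} (hx : 1 ≤ x) {θ' θ : ℝ}
    (hθ : θ' ≤ θ) :
    ∑ d ∈ (Finset.Icc 1 ⌊(x : ℝ) ^ θ'⌋₊).filter Squarefree,
        ∑ c ∈ (Finset.range d).filter (fun c : ℕ => (d : ℤ) ∣ (∏ i, f i).eval (c : ℤ)),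
          |∑ n ∈ (Finset.Icc 1 x).filter (fun n : ℕ => n % d = c), τ n| ≤
      ∑ d ∈ (Finset.Icc 1 ⌊(x : ℝ) ^ θ⌋₊).filter Squarefree,
        ∑ c ∈ (Finset.range d).filter (fun c : ℕ => (d : ℤ) ∣ (∏ i, f i).eval (c : ℤ)),
          |∑ n ∈ (Finset.Icc 1 x).filter (fun n : ℕ => n % d = c), τ n| := by
  refine Finset.sum_le_sum_of_subset_of_nonneg (fun d hd => ?_)
    fun d _ _ => Finset.sum_nonneg fun c _ => abs_nonneg _
  rw [Finset.mem_filter, Finset.mem_Icc] at hd ⊢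
  have hx1 : (1 : ℝ) ≤ x := by exact_mod_cast hx
  exact ⟨⟨hd.1.1, hd.1.2.trans (Nat.floor_le_floor (Real.rpow_le_rpow_of_exponent_le hx1 hθ))⟩, hd.2⟩

/-- **Generic composition (PROVED from E2 and E4).**  If a weight `|τ| ≤ 1` has class sums
`Σ_{d ≤ x^θ sqfree} Σ_{c : d ∣ ∏fᵢ(c)} |Σ_{n ≤ x, n ≡ c (d)} τ(n)| ≪_A x/(log x)^A` for EVERY `A` at SOME level
`θ = θ(A) > 0`, then its mean over the jointly rough set is `o(#R)` as `U → ∞`: for every `δ > 0` there is `U₀`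
with `|Σ_{n ∈ R_f(x,U)} τ(n)| ≤ δ·#R_f(x,U)` for `U ≥ U₀`, eventually in `x`.  Proof: `stub_roughCardLower` gives
`A₀`; take the hypothesis at `A₀ + 1` (level `θ`, shrink to `min θ (1/4)` by `classSums_mono`),
`stub_signedSieveOut` at `ε = δ/2`; then `C x/(log x)^{A₀+1} ≤ (δ/2) x/(log x)^{A₀} ≤ (δ/2)#R` once
`log x ≥ 2|C|/δ`. [folklore assembly] -/
theorem signSum_le_of_classSums {k : ℕ} {f : Fin k → Polynomial ℤ} (hf : IsBatemanHornSystem f)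
    (τ : ℕ → ℝ) (hτ : ∀ n, |τ n| ≤ 1)
    (H : ∀ A : ℝ, ∃ θ : ℝ, 0 < θ ∧ ∃ C : ℝ, ∀ᶠ x : ℕ in Filter.atTop,
      ∑ d ∈ (Finset.Icc 1 ⌊(x : ℝ) ^ θ⌋₊).filter Squarefree,
        ∑ c ∈ (Finset.range d).filter (fun c : ℕ => (d : ℤ) ∣ (∏ j, f j).eval (c : ℤ)),
          |∑ n ∈ (Finset.Icc 1 x).filter (fun n : ℕ => n % d = c), τ n| ≤ C * x / Real.log x ^ A) :
    ∀ δ : ℝ, 0 < δ → ∃ U₀ : ℝ, ∀ U : ℝ, U₀ ≤ U → ∀ᶠ x : ℕ in Filter.atTop,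
      |∑ n ∈ (Finset.Icc 1 x).filter (fun n : ℕ => ∀ i, 0 < (f i).eval (n : ℤ) ∧
          ∀ p ∈ Finset.range ⌈(x : ℝ) ^ (((f i).natDegree : ℝ) / U)⌉₊,
            p.Prime → ¬ ((p : ℤ) ∣ (f i).eval (n : ℤ))), τ n| ≤
        δ * ((((Finset.Icc 1 x).filter (fun n : ℕ => ∀ i, 0 < (f i).eval (n : ℤ) ∧
          ∀ p ∈ Finset.range ⌈(x : ℝ) ^ (((f i).natDegree : ℝ) / U)⌉₊,
            p.Prime → ¬ ((p : ℤ) ∣ (f i).eval (n : ℤ)))).card : ℕ) : ℝ) := by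
  intro δ hδ
  have hδ2 : (0 : ℝ) < δ / 2 := by positivity
  obtain ⟨A, U₁', hlow⟩ := stub_roughCardLower k f hf
  obtain ⟨θ, hθ, C, hC⟩ := H (A + 1)
  have hθ' : 0 < min θ (1 / 4) := lt_min hθ (by norm_num)
  obtain ⟨U₁, hT⟩ := stub_signedSieveOut k f hf (δ / 2) hδ2 (min θ (1 / 4)) hθ' (min_le_right _ _)
  refine ⟨max U₁ U₁', fun U hU => ?_⟩
  have hU₁ : U₁ ≤ U := le_trans (le_max_left _ _) hU
  have hU₁' : U₁' ≤ U := le_trans (le_max_right _ _) hU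
  -- eventually `log x ≥ max(1, 2|C|/δ)`
  have hlog : ∀ᶠ x : ℕ in Filter.atTop, 2 * |C| / δ ≤ Real.log x ∧ 1 ≤ Real.log x :=
    (Real.tendsto_log_atTop.comp tendsto_natCast_atTop_atTop).eventually
      ((Filter.eventually_ge_atTop _).and (Filter.eventually_ge_atTop _))
  filter_upwards [hT U hU₁, hlow U hU₁', hC, hlog, Filter.eventually_ge_atTop 1]
    with x hTx hlowx hCx hlogx hx1
  set R : Finset ℕ := (Finset.Icc 1 x).filter (fun n : ℕ => ∀ i, 0 < (f i).eval (n : ℤ) ∧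
      ∀ p ∈ Finset.range ⌈(x : ℝ) ^ (((f i).natDegree : ℝ) / U)⌉₊,
        p.Prime → ¬ ((p : ℤ) ∣ (f i).eval (n : ℤ))) with hR
  have hx0 : (0 : ℝ) < x := by exact_mod_cast hx1
  have hL1 : (1 : ℝ) ≤ Real.log x := hlogx.2
  have hL0 : (0 : ℝ) < Real.log x := by linarith
  -- the class sums are `≤ (δ/2) x/(log x)^A ≤ (δ/2) #R`
  have hrem : C * x / Real.log x ^ (A + 1) ≤ δ / 2 * ((x : ℝ) / Real.log x ^ A) := by
    have hpow : Real.log x ^ (A + 1) = Real.log x ^ A * Real.log x := by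
      rw [Real.rpow_add hL0, Real.rpow_one]
    have hA0 : 0 < Real.log x ^ A := Real.rpow_pos_of_pos hL0 A
    have hClog : C ≤ δ / 2 * Real.log x := by
      have h1 : 2 * |C| / δ ≤ Real.log x := hlogx.1
      rw [div_le_iff₀ hδ] at h1
      have h2 : |C| ≤ δ / 2 * Real.log x := by linarith
      exact (le_abs_self C).trans h2
    rw [hpow, div_le_iff₀ (by positivity)]
    calc C * x ≤ (δ / 2 * Real.log x) * x := mul_le_mul_of_nonneg_right hClog hx0.le
      _ = δ / 2 * (x / Real.log x ^ A) * (Real.log x ^ A * Real.log x) := by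
          field_simp
  calc |∑ n ∈ R, τ n|
      ≤ δ / 2 * ((R.card : ℕ) : ℝ) + ∑ d ∈ (Finset.Icc 1 ⌊(x : ℝ) ^ (min θ (1 / 4))⌋₊).filter Squarefree,
          ∑ c ∈ (Finset.range d).filter (fun c : ℕ => (d : ℤ) ∣ (∏ j, f j).eval (c : ℤ)),
            |∑ n ∈ (Finset.Icc 1 x).filter (fun n : ℕ => n % d = c), τ n| := hTx τ hτ
    _ ≤ δ / 2 * ((R.card : ℕ) : ℝ) + ∑ d ∈ (Finset.Icc 1 ⌊(x : ℝ) ^ θ⌋₊).filter Squarefree,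
          ∑ c ∈ (Finset.range d).filter (fun c : ℕ => (d : ℤ) ∣ (∏ j, f j).eval (c : ℤ)),
            |∑ n ∈ (Finset.Icc 1 x).filter (fun n : ℕ => n % d = c), τ n| := by
        have hmono := classSums_mono f τ hx1 (min_le_left θ (1 / 4))
        linarith
    _ ≤ δ / 2 * ((R.card : ℕ) : ℝ) + C * x / Real.log x ^ (A + 1) := by gcongr
    _ ≤ δ / 2 * ((R.card : ℕ) : ℝ) + δ / 2 * ((x : ℝ) / Real.log x ^ A) := by linarith [hrem]
    _ ≤ δ / 2 * ((R.card : ℕ) : ℝ) + δ / 2 * ((R.card : ℕ) : ℝ) := by gcongr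
    _ = δ * ((R.card : ℕ) : ℝ) := by ring

/-- `|λ(m)| ≤ 1` (as a real number; `λ(0) = 0`). [folklore] -/
theorem abs_liouville_cast_le_one (m : ℕ) : |((ArithmeticFunction.liouville m : ℤ) : ℝ)| ≤ 1 := by
  by_cases h0 : m = 0
  · simp [h0]
  · rw [ArithmeticFunction.liouville_apply h0]; push_cast; simp [abs_pow]

/-- On a positive value the sign `(−1)^{Ω(v⁺)}` is `λ(v⁺)`. [folklore] -/
theorem neg_one_pow_cardFactors_eq_liouville {v : ℤ} (hv : 0 < v) :
    (-1 : ℝ) ^ ArithmeticFunction.cardFactors v.toNat = ((ArithmeticFunction.liouville v.toNat : ℤ) : ℝ) := by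
  have h0 : v.toNat ≠ 0 := by
    intro h; rw [Int.toNat_eq_zero] at h; exact absurd hv (not_lt.mpr h)
  rw [ArithmeticFunction.liouville_apply h0]; push_cast; rfl

/-! ### The linear member (the birth skeleton's `stub_linearMemberSign`): E2 + E3 + E4 -/

/-- **`stub_linearMemberSign` (first-order Walsh coefficient of a LINEAR member; the registered stub of the
line, verbatim) — PROVED from the landed engine stubs.**  For every Bateman–Horn system `f` of `k` polynomials, every index `i` with `deg fᵢ = 1` and every
`δ > 0` there is `U₀` such that for every `U ≥ U₀`, eventually in `x`,
`|Σ_{n ∈ R_f(x,U)} (−1)^{Ω(fᵢ(n))}| ≤ δ · #R_f(x,U)`.  Proof: on `R` the summand is `λ(fᵢ(n)⁺)` (`fᵢ(n) > 0`);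
`signSum_le_of_classSums` with the class-sum bound `stub_linearClassSums` (level `θ = 1/8` for every `A`).
[Alladi1982Moebius (k = 1, f = X); folklore assembly] -/
theorem stub_linearMemberSign :
    ∀ (k : ℕ) (f : Fin k → Polynomial ℤ), IsBatemanHornSystem f →
      ∀ i : Fin k, (f i).natDegree = 1 → ∀ δ : ℝ, 0 < δ → ∃ U₀ : ℝ, ∀ U : ℝ, U₀ ≤ U →
        ∀ᶠ x : ℕ in Filter.atTop,
          |∑ n ∈ (Finset.Icc 1 x).filter (fun n : ℕ => ∀ i, 0 < (f i).eval (n : ℤ) ∧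
              ∀ p ∈ Finset.range ⌈(x : ℝ) ^ (((f i).natDegree : ℝ) / U)⌉₊,
                p.Prime → ¬ ((p : ℤ) ∣ (f i).eval (n : ℤ))),
              (-1 : ℝ) ^ ArithmeticFunction.cardFactors (((f i).eval (n : ℤ)).toNat)| ≤
            δ * ((((Finset.Icc 1 x).filter (fun n : ℕ => ∀ i, 0 < (f i).eval (n : ℤ) ∧
              ∀ p ∈ Finset.range ⌈(x : ℝ) ^ (((f i).natDegree : ℝ) / U)⌉₊,
                p.Prime → ¬ ((p : ℤ) ∣ (f i).eval (n : ℤ)))).card : ℕ) : ℝ) := by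
  intro k f hf i hdeg δ hδ
  set τ : ℕ → ℝ := fun n => ((ArithmeticFunction.liouville (((f i).eval (n : ℤ)).toNat) : ℤ) : ℝ)
    with hτdef
  have hτ : ∀ n, |τ n| ≤ 1 := fun n => abs_liouville_cast_le_one _
  have H : ∀ A : ℝ, ∃ θ : ℝ, 0 < θ ∧ ∃ C : ℝ, ∀ᶠ x : ℕ in Filter.atTop,
      ∑ d ∈ (Finset.Icc 1 ⌊(x : ℝ) ^ θ⌋₊).filter Squarefree,
        ∑ c ∈ (Finset.range d).filter (fun c : ℕ => (d : ℤ) ∣ (∏ j, f j).eval (c : ℤ)),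
          |∑ n ∈ (Finset.Icc 1 x).filter (fun n : ℕ => n % d = c), τ n| ≤ C * x / Real.log x ^ A :=
    fun A => ⟨1 / 8, by norm_num, stub_linearClassSums k f hf i hdeg A⟩
  obtain ⟨U₀, hU₀⟩ := signSum_le_of_classSums hf τ hτ H δ hδ
  refine ⟨U₀, fun U hU => (hU₀ U hU).mono fun x hx => ?_⟩
  have hsum : ∑ n ∈ (Finset.Icc 1 x).filter (fun n : ℕ => ∀ i, 0 < (f i).eval (n : ℤ) ∧
      ∀ p ∈ Finset.range ⌈(x : ℝ) ^ (((f i).natDegree : ℝ) / U)⌉₊,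
        p.Prime → ¬ ((p : ℤ) ∣ (f i).eval (n : ℤ))),
        (-1 : ℝ) ^ ArithmeticFunction.cardFactors (((f i).eval (n : ℤ)).toNat) =
      ∑ n ∈ (Finset.Icc 1 x).filter (fun n : ℕ => ∀ i, 0 < (f i).eval (n : ℤ) ∧
      ∀ p ∈ Finset.range ⌈(x : ℝ) ^ (((f i).natDegree : ℝ) / U)⌉₊,
        p.Prime → ¬ ((p : ℤ) ∣ (f i).eval (n : ℤ))), τ n :=
    Finset.sum_congr rfl fun n hn =>
      neg_one_pow_cardFactors_eq_liouville ((Finset.mem_filter.mp hn).2 i).1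
  rw [hsum]; exact hx

/-! ### Bridges for the two OPEN atoms: unsifted level-`x^θ` class-sum bounds suffice (E2 + E4) -/

/-- **Bridge for atom 2.**  If for a NON-LINEAR member `fᵢ` the Liouville class sums along `fᵢ`,
`Σ_{d ≤ x^θ sqfree} Σ_{c : d ∣ ∏fⱼ(c)} |Σ_{n ≤ x, n ≡ c (d)} λ(fᵢ(n)⁺)|`, are `≪_A x/(log x)^A` for every `A` at some
level `θ(A) > 0` (one-point Chowla along `fᵢ` in arithmetic progressions ON AVERAGE over moduli `≤ x^θ`, with a
log-power saving — UNSIFTED, open for every `fᵢ` of degree ≥ 2), then `stub_nonlinearMemberSign` holds for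
`(f, i)`.  This is the exact typed input the atom reduces to by the signed sieve-out. [folklore assembly] -/
theorem nonlinearMemberSign_of_classSums {k : ℕ} {f : Fin k → Polynomial ℤ} (hf : IsBatemanHornSystem f)
    (i : Fin k)
    (H : ∀ A : ℝ, ∃ θ : ℝ, 0 < θ ∧ ∃ C : ℝ, ∀ᶠ x : ℕ in Filter.atTop,
      ∑ d ∈ (Finset.Icc 1 ⌊(x : ℝ) ^ θ⌋₊).filter Squarefree,
        ∑ c ∈ (Finset.range d).filter (fun c : ℕ => (d : ℤ) ∣ (∏ j, f j).eval (c : ℤ)),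
          |∑ n ∈ (Finset.Icc 1 x).filter (fun n : ℕ => n % d = c),
            (ArithmeticFunction.liouville (((f i).eval (n : ℤ)).toNat) : ℝ)| ≤ C * x / Real.log x ^ A) :
    ∀ δ : ℝ, 0 < δ → ∃ U₀ : ℝ, ∀ U : ℝ, U₀ ≤ U → ∀ᶠ x : ℕ in Filter.atTop,
      |∑ n ∈ (Finset.Icc 1 x).filter (fun n : ℕ => ∀ i, 0 < (f i).eval (n : ℤ) ∧
          ∀ p ∈ Finset.range ⌈(x : ℝ) ^ (((f i).natDegree : ℝ) / U)⌉₊,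
            p.Prime → ¬ ((p : ℤ) ∣ (f i).eval (n : ℤ))),
          (-1 : ℝ) ^ ArithmeticFunction.cardFactors (((f i).eval (n : ℤ)).toNat)| ≤
        δ * ((((Finset.Icc 1 x).filter (fun n : ℕ => ∀ i, 0 < (f i).eval (n : ℤ) ∧
          ∀ p ∈ Finset.range ⌈(x : ℝ) ^ (((f i).natDegree : ℝ) / U)⌉₊,
            p.Prime → ¬ ((p : ℤ) ∣ (f i).eval (n : ℤ)))).card : ℕ) : ℝ) := by
  intro δ hδ
  set τ : ℕ → ℝ := fun n => ((ArithmeticFunction.liouville (((f i).eval (n : ℤ)).toNat) : ℤ) : ℝ)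
    with hτdef
  obtain ⟨U₀, hU₀⟩ := signSum_le_of_classSums hf τ (fun n => abs_liouville_cast_le_one _) H δ hδ
  refine ⟨U₀, fun U hU => (hU₀ U hU).mono fun x hx => ?_⟩
  rw [Finset.sum_congr rfl fun n hn =>
    neg_one_pow_cardFactors_eq_liouville ((Finset.mem_filter.mp hn).2 i).1]
  exact hx

/-- **Bridge for atom 3.**  If for a set `S` of members the class sums of the product weight
`τ_S(n) = ∏_{i∈S} λ(fᵢ(n)⁺)`, `Σ_{d ≤ x^θ sqfree} Σ_{c : d ∣ ∏fⱼ(c)} |Σ_{n ≤ x, n ≡ c (d)} τ_S(n)|`, are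
`≪_A x/(log x)^A` for every `A` at some level `θ(A) > 0` (`|S|`-point Chowla/Elliott along the sub-tuple in
arithmetic progressions on average — UNSIFTED, open for `|S| ≥ 2`), then `stub_jointSignIndependence` holds for
`(f, S)`. [folklore assembly] -/
theorem jointSignIndependence_of_classSums {k : ℕ} {f : Fin k → Polynomial ℤ} (hf : IsBatemanHornSystem f)
    (S : Finset (Fin k))
    (H : ∀ A : ℝ, ∃ θ : ℝ, 0 < θ ∧ ∃ C : ℝ, ∀ᶠ x : ℕ in Filter.atTop,
      ∑ d ∈ (Finset.Icc 1 ⌊(x : ℝ) ^ θ⌋₊).filter Squarefree,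
        ∑ c ∈ (Finset.range d).filter (fun c : ℕ => (d : ℤ) ∣ (∏ j, f j).eval (c : ℤ)),
          |∑ n ∈ (Finset.Icc 1 x).filter (fun n : ℕ => n % d = c),
            ∏ i ∈ S, (ArithmeticFunction.liouville (((f i).eval (n : ℤ)).toNat) : ℝ)| ≤
          C * x / Real.log x ^ A) :
    ∀ δ : ℝ, 0 < δ → ∃ U₀ : ℝ, ∀ U : ℝ, U₀ ≤ U → ∀ᶠ x : ℕ in Filter.atTop,
      |∑ n ∈ (Finset.Icc 1 x).filter (fun n : ℕ => ∀ i, 0 < (f i).eval (n : ℤ) ∧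
          ∀ p ∈ Finset.range ⌈(x : ℝ) ^ (((f i).natDegree : ℝ) / U)⌉₊,
            p.Prime → ¬ ((p : ℤ) ∣ (f i).eval (n : ℤ))),
          ∏ i ∈ S, (-1 : ℝ) ^ ArithmeticFunction.cardFactors (((f i).eval (n : ℤ)).toNat)| ≤
        δ * ((((Finset.Icc 1 x).filter (fun n : ℕ => ∀ i, 0 < (f i).eval (n : ℤ) ∧
          ∀ p ∈ Finset.range ⌈(x : ℝ) ^ (((f i).natDegree : ℝ) / U)⌉₊,
            p.Prime → ¬ ((p : ℤ) ∣ (f i).eval (n : ℤ)))).card : ℕ) : ℝ) := by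
  intro δ hδ
  set τ : ℕ → ℝ := fun n => ∏ i ∈ S, ((ArithmeticFunction.liouville (((f i).eval (n : ℤ)).toNat) : ℤ) : ℝ)
    with hτdef
  have hτ : ∀ n, |τ n| ≤ 1 := by
    intro n
    simp only [hτdef]
    rw [Finset.abs_prod]
    exact Finset.prod_le_one (fun i _ => abs_nonneg _) fun i _ => abs_liouville_cast_le_one _
  obtain ⟨U₀, hU₀⟩ := signSum_le_of_classSums hf τ hτ H δ hδ
  refine ⟨U₀, fun U hU => (hU₀ U hU).mono fun x hx => ?_⟩
  rw [Finset.sum_congr rfl fun n hn => Finset.prod_congr rfl fun i _ =>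
    neg_one_pow_cardFactors_eq_liouville ((Finset.mem_filter.mp hn).2 i).1]
  exact hx

end Summit.Parity.BatemanHorn.Cruxes.RoughParityBalance.Birth
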